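import Literature.Analysis.FluidPDE.LerayHopfCrossIdentityTorus
import Literature.Analysis.FluidPDE.LerayHopfUniformEnergyMomentum
import Literature.Analysis.FunctionSpaces.TorusFourierModes
import Literature.Analysis.FunctionSpaces.TorusVectorParseval
import HarnessLib

/-!
# Finite-mode condensation, stub FM-PATH: the low-mode path of a planar Leray–Hopf flow

Crux `TwoAndHalfD.TwohalfdNeg` (stmt-AnomalousDissipation-0211), line
`log-kantorovich-enstrophy-transfer`, finite-mode condensation corollary of the regular-condensate
theorem (lead c7, wave 3). This file is the stub `stub_fmTruncationPath` (FM-PATH): for a global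
planar Leray–Hopf flow `v` driven by a steady smooth mean-zero force `g` at viscosity `κ > 0` and a
truncation level `K`, the space–time low-mode field `(t, x) ↦ P_K v(t)(x)`
(`Torus.fourierTruncate K (v t) x`) is

1. jointly continuous on `(0, ∞) × T²`: along the Galerkin frame `g_{kjc}` (`Torus.frameField`)
   the truncation of the weakly divergence-free slice `v(t)`, `t > 0`, is the FINITE sum
   `P_K v(t)(x) = ∑_{|k| ≤ K, j, c} ⟪v(t), g_{kjc}⟫_{L²} g_{kjc}(x)`
   (`Torus.fourierTruncate_eq_sum_integral_inner_smul_frameField`); each coefficient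
   `t ↦ ⟪v(t), g_{kjc}⟫` is continuous on `(0, ∞)` by the weak `L²`-continuity of Leray–Hopf
   solutions on every `(0, T]` (field `weak_continuous`, horizon `T = t + 1`), and each `g_{kjc}`
   is continuous in `x`;
2. bounded on `t > 0`: `‖P_K u(x)‖ ≤ ∑_{|k| ≤ K} ‖û(k)‖` (`Torus.norm_realTrigPoly_apply_le`),
   `‖û(k)‖² ≤ ∫ ‖u‖²` (Bessel, `Torus.hasSum_sq_norm_mFourierCoeff_complexify`), and the
   trajectory of a global Leray–Hopf flow with steady mean-zero `L²` force is bounded in `L²`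
   uniformly in `t ≥ 0` (FMRT 2001, Ch. IV (3.2):
   `Torus.IsGlobalLerayHopf.exists_forall_integral_norm_sq_le_of_hasZeroMean`), whence
   `‖P_K v(t)(x)‖ ≤ #{|k| ≤ K} · √R`.

Sources: standard (weak continuity of Leray–Hopf solutions: Galdi 2000, Lemma 2.2; Galerkin
truncation: Robinson–Rodrigo–Sadowski 2016, §4.1; uniform energy bound: Foias–Manley–Rosa–Temam
2001, Ch. IV (3.2)) [folklore]. Not here: the block energy bound, the Lipschitz estimate of the
clamped truncation and the block selection (neighbouring stubs FM-SUP, FM-LIP, FM-SEL).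
-/

noncomputable section

namespace Summit.AnomalousDissipation.AnomalousDissipation.Theorems.TwohalfdNeg.FiniteModeCondensate

open MeasureTheory Filter Topology Set Function UnitAddTorus
open scoped ENNReal NNReal InnerProductSpace
open Literature.Analysis.FunctionSpaces Literature.Analysis.FluidPDE

-- the summit and the problem are both `AnomalousDissipation` (path convention), hence the dup:
set_option linter.dupNamespace false

namespace TruncationPath

variable {d : Type*} [Fintype d] [DecidableEq d]
variable {ν : ℝ} {f : ℝ → UnitAddTorus d → EuclideanSpace ℝ d}
  {u₀ : UnitAddTorus d → EuclideanSpace ℝ d} {u : ℝ → UnitAddTorus d → EuclideanSpace ℝ d}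

/-- **Weak `L²`-continuity on the open half-line.** Along a global Leray–Hopf flow on `T^d` the
pairing `t ↦ ⟪u(t), w⟫_{L²}` with a fixed `w ∈ L²` is continuous on `(0, ∞)` (it is continuous on
every `(0, T]`, field `weak_continuous`; take `T = t + 1` around each `t > 0`; Galdi 2000,
Lemma 2.2). [folklore] -/
theorem continuousOn_integral_inner_Ioi (hu : Torus.IsGlobalLerayHopf ν f u₀ u)
    {w : UnitAddTorus d → EuclideanSpace ℝ d} (hw : MemLp w 2 volume) :
    ContinuousOn (fun t => ∫ x, ⟪u t x, w x⟫_ℝ) (Ioi 0) := by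
  refine continuousOn_of_forall_continuousAt fun t ht => ?_
  have ht0 : 0 < t := ht
  exact ((hu (t + 1) (by linarith)).weak_continuous w hw).1.continuousAt
    (Ioc_mem_nhds ht0 (lt_add_one t))

/-- **Joint continuity of the low-mode path.** Along a global Leray–Hopf flow on `T^d`, the
space–time field `(t, x) ↦ P_K u(t)(x)` is continuous on `(0, ∞) × T^d`: on that set it is the
finite frame sum `∑_{|k| ≤ K, j, c} ⟪u(t), g_{kjc}⟫ g_{kjc}(x)` (every slice `u(t)`, `t > 0`, is in
`L²` and weakly divergence free), a finite sum of products of a function continuous in `t` on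
`(0, ∞)` and a function continuous in `x` (Robinson–Rodrigo–Sadowski 2016, §4.1). [folklore] -/
theorem continuousOn_uncurry_fourierTruncate (hu : Torus.IsGlobalLerayHopf ν f u₀ u) (K : ℕ) :
    ContinuousOn (uncurry fun t x => Torus.fourierTruncate K (u t) x) (Ioi 0 ×ˢ univ) := by
  set S : Finset ((d → ℤ) × d × Bool) :=
    Torus.freqBall K ×ˢ ((Finset.univ : Finset d) ×ˢ (Finset.univ : Finset Bool))
  have hg : ContinuousOn (fun p : ℝ × UnitAddTorus d => ∑ i ∈ S,
      (∫ y, ⟪u p.1 y, Torus.frameField i.1 i.2.1 i.2.2 y⟫_ℝ) • Torus.frameField i.1 i.2.1 i.2.2 p.2)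
      (Ioi 0 ×ˢ univ) := by
    refine continuousOn_finsetSum S fun i _ => ContinuousOn.fun_smul ?_ ?_
    · exact (continuousOn_integral_inner_Ioi hu (Torus.memLp_frameField _ _ _ 2)).comp
        continuous_fst.continuousOn fun p hp => hp.1
    · exact ((Torus.continuous_frameField _ _ _).comp continuous_snd).continuousOn
  refine hg.congr fun p hp => ?_
  have ht : 0 < p.1 := hp.1
  show Torus.fourierTruncate K (u p.1) p.2 = _
  rw [Torus.fourierTruncate_eq_sum_integral_inner_smul_frameField (hu.memLp_two ht.le)
    ((hu (p.1 + 1) (by linarith)).isWeaklyDivFree_of_mem_Ioc ⟨ht, by linarith⟩) K]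

omit [DecidableEq d] in
/-- **A single Fourier coefficient is bounded by the energy**: `‖ŵ(k)‖ ≤ √R` whenever
`∫ ‖w‖² ≤ R`, `w ∈ L²` (one term of Bessel's inequality `∑ₖ ‖ŵ(k)‖² = ∫ ‖w‖²`). [folklore] -/
theorem norm_mFourierCoeff_le_sqrt {w : UnitAddTorus d → EuclideanSpace ℝ d} (hw : MemLp w 2 volume)
    {R : ℝ} (hR : ∫ x, ‖w x‖ ^ 2 ≤ R) (k : d → ℤ) :
    ‖mFourierCoeff (EuclideanSpace.complexify ∘ w) k‖ ≤ Real.sqrt R := by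
  refine Real.le_sqrt_of_sq_le ?_
  exact (le_hasSum (Torus.hasSum_sq_norm_mFourierCoeff_complexify hw) k
    fun _ _ => sq_nonneg _).trans hR

/-- **Sup bound of the truncation by the energy**: `‖P_K w(x)‖ ≤ #{|k| ≤ K} · √R` whenever
`∫ ‖w‖² ≤ R`, `w ∈ L²` (`‖P_K w(x)‖ ≤ ∑_{|k| ≤ K} ‖ŵ(k)‖` and `‖ŵ(k)‖ ≤ √R`). [folklore] -/
theorem norm_fourierTruncate_apply_le_card_mul_sqrt {w : UnitAddTorus d → EuclideanSpace ℝ d}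
    (hw : MemLp w 2 volume) {R : ℝ} (hR : ∫ x, ‖w x‖ ^ 2 ≤ R) (K : ℕ) (x : UnitAddTorus d) :
    ‖Torus.fourierTruncate K w x‖ ≤ (Torus.freqBall (d := d) K).card * Real.sqrt R := by
  rw [Torus.fourierTruncate_eq]
  refine (Torus.norm_realTrigPoly_apply_le _ _ x).trans ?_
  calc ∑ k ∈ Torus.freqBall K, ‖mFourierCoeff (EuclideanSpace.complexify ∘ w) k‖
      ≤ ∑ _k ∈ Torus.freqBall K, Real.sqrt R :=
        Finset.sum_le_sum fun k _ => norm_mFourierCoeff_le_sqrt hw hR k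
    _ = (Torus.freqBall (d := d) K).card * Real.sqrt R := by rw [Finset.sum_const, nsmul_eq_mul]

end TruncationPath

/-- **FM-PATH `stub_fmTruncationPath` — the low-mode path of a Leray–Hopf flow.** For a global
planar Leray–Hopf flow `v` (steady smooth mean-zero force `g`, viscosity `κ > 0`) and a truncation
level `K`, the space–time field `(t, x) ↦ P_K v(t)(x)` (`Torus.fourierTruncate K`) is jointly
continuous on `(0, ∞) × T²` (weak `L²`-continuity of `v` on `(0, T]` for every `T`, finitely many
frame coefficients: `TruncationPath.continuousOn_uncurry_fourierTruncate`) and bounded on `t > 0`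
(the uniform energy bound `Torus.IsGlobalLerayHopf.exists_forall_integral_norm_sq_le_of_hasZeroMean`,
FMRT 2001, Ch. IV (3.2), and `‖P_K w(x)‖ ≤ #{|k| ≤ K} √(∫‖w‖²)`,
`TruncationPath.norm_fourierTruncate_apply_le_card_mul_sqrt`). [folklore] -/
theorem stub_fmTruncationPath :
    ∀ (κ : ℝ) (K : ℕ) (g v₀ : UnitAddTorus (Fin 2) → EuclideanSpace ℝ (Fin 2))
      (v : ℝ → UnitAddTorus (Fin 2) → EuclideanSpace ℝ (Fin 2)),
      0 < κ → Torus.IsSmooth g → Torus.HasZeroMean g → Torus.IsGlobalLerayHopf κ (fun _ => g) v₀ v →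
      ContinuousOn (Function.uncurry fun t x => Torus.fourierTruncate K (v t) x) (Set.Ioi 0 ×ˢ Set.univ) ∧
        ∃ B : ℝ, ∀ t, 0 < t → ∀ x, ‖Torus.fourierTruncate K (v t) x‖ ≤ B := by
  intro κ K g v₀ v hκ hg hg0 hv
  refine ⟨TruncationPath.continuousOn_uncurry_fourierTruncate hv K, ?_⟩
  obtain ⟨R, hR⟩ := hv.exists_forall_integral_norm_sq_le_of_hasZeroMean hκ (hg.memLp 2) hg0
  exact ⟨(Torus.freqBall (d := Fin 2) K).card * Real.sqrt R, fun t ht x =>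
    TruncationPath.norm_fourierTruncate_apply_le_card_mul_sqrt (hv.memLp_two ht.le) (hR t ht.le) K x⟩

end Summit.AnomalousDissipation.AnomalousDissipation.Theorems.TwohalfdNeg.FiniteModeCondensate
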